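import Summits.BirchSwinnertonDyer.BirchSwinnertonDyer.Theorems.ByReductionTypeAtTwoRankOneAtTwoOneDoorLawDefs
import Summits.BirchSwinnertonDyer.BirchSwinnertonDyer.Theorems.SchneiderFreeAdditiveX3HeegnerTwistEqualities
import Summits.BirchSwinnertonDyer.Rank1Residual.X2.TwistKodaira
import Literature.NumberTheory.EllipticCurves.QuadraticTwistTamagawaI0starExactProofs
import Literature.NumberTheory.EllipticCurves.MatsunoTwistedCurvesLocalProofs
import Literature.NumberTheory.EllipticCurves.KramerDescentLocalGeneratorsProofs
import HarnessLib

/-!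
# Route ByReductionTypeAtTwo, crux `RankOneAtTwoBigImageOddLocal` (stmt-BirchSwinnertonDyer-23715), line `one_door_law`:
# the registered stub `stub_doorTamagawa : DoorTwistTamagawaAtTwo` (V3 of the reshaped value stub, skeleton v7.3) PROVED

Width seat `bsd-line-fkl-p2` g6 under the lead `bsd-line-fkl-p1` g6 (2026-08-28).  The value stub
`DoorTwistValueAtTwo` of the line was reshaped (v7.3, `…OneDoorLawDefs.lean` APPEND) into (V1) the rank-`0`
`2`-converse, (V2) rank-`0` `BSD₂` of the `Sel₂`-trivial twist and (V3) the TAMAGAWA BOOKKEEPING of the minimal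
twist model at the door primes,

  `DoorTwistTamagawaAtTwo : ∀ W d, DoorAdmissible W d → ∀ Wd Cd, Cd • W^{(d)} = Wd →
     ord₂ ∏_ℓ c_ℓ(Wd) = ord₂ ∏_ℓ c_ℓ(W) + t(W,d) + 2·s(W,d)`,

"kernel-provable from the tree's Tate algorithm, not yet done".  This file PROVES it
(`doorTwistTamagawaAtTwo`, alias `stub_doorTamagawa`), unconditionally, from:

* the EXACT type-`I₀*` count `c = 1 + #{roots of the Step-6 cubic}` over a Henselian DVR
  (`Literature/…/NeronComponentIndexTypeI0starExactProofs.lean`, p614342) and its specialisation to the door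
  primes: at a good odd `q ∥ d`, for ANY equation `Wd` of `W^{(d)}`,
  `ord₂ c_q(Wd) = [(Δ_min/q) = −1] + 2·[(Δ_min/q) = 1 ∧ a_q even]`
  (`Literature/…/QuadraticTwistTamagawaI0starExactProofs.lean`, p615631:
  `TwistIstar.padicValNat_two_localTamagawaNumber_twist_of_dvd`; `c_q = #Ẽ(𝔽_q)[2] ∈ {1, 2, 4}` read off the
  Frobenius class of `q` on `E[2]`: transposition / `3`-cycle / identity);
* at a prime `ℓ ∤ d`: if `ℓ` is bad for `W` then `d ∈ (ℚ_ℓ^×)²` (`ℓ = 2`: `d ≡ 1 (mod 8)`,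
  `KramerLocal.padicTwo_isSquare_intCast`; `ℓ` odd: `(d/ℓ) = 1`, `padic_isSquare_of_jacobiSym_eq_one`), so
  `Wd ≅ W` over `ℚ_ℓ` and `c_ℓ(Wd) = c_ℓ(W)` (`localTamagawaNumber_variableChange_holds`); if `ℓ` is good for `W`
  then `c_ℓ(Wd) = c_ℓ(W) = 1` (`X2.localTamagawaNumber_twist_of_not_dvd`, `d ≡ 1 (mod 4)`);
* the finite-product form of `∏ c_ℓ` over the bad places of `W`, `Wd` and the primes of `d`
  (`tamagawaProduct_eq_prod`), and the count `Σ_{q ∣ d} ([(Δ/q) = −1] + 2[(Δ/q) = 1 ∧ 2 ∣ a_q]) = t + 2s`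
  (`transpCount`, `identCount` are the filtered prime factors of `|d|`).

No hypothesis beyond `DoorAdmissible W d` (`d < 0` is not used).  BSD is not proved by any of this: the statement is
local arithmetic of Tamagawa numbers (Kramer 1981 Prop. 3 / Tate's algorithm case `I₀*`), one of three inputs of the
line's value law, whose other inputs (`DoorTwistConverseAtTwo`, the route's rank-`0` cruxes) and the door index law
`DoorIndexLawAtTwo` remain open.
-/

set_option autoImplicit false
set_option linter.dupNamespace false

noncomputable section

open scoped Classical

namespace Summit.BirchSwinnertonDyer.BirchSwinnertonDyer.Theorems.RankOneAtTwoOneDoor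

open WeierstrassCurve IsDedekindDomain NumberField Rat.HeightOneSpectrum
  Literature.NumberTheory.EllipticCurves Literature.NumberTheory.EllipticCurves.TwistIstar
  Summit.BirchSwinnertonDyer.Rank1Residual

/-! ### §1 Local comparison at the primes `ℓ ∤ d` -/

/-- `ord_p` of a finite product of non-zero naturals is the sum of the `ord_p`. [folklore] -/
private theorem padicValNat_finset_prod (p : ℕ) [Fact p.Prime] {ι : Type*} (s : Finset ι)
    (f : ι → ℕ) (hf : ∀ i ∈ s, f i ≠ 0) :
    padicValNat p (∏ i ∈ s, f i) = ∑ i ∈ s, padicValNat p (f i) := by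
  induction s using Finset.induction_on with
  | empty => simp
  | insert a s ha ih =>
    rw [Finset.prod_insert ha, Finset.sum_insert ha,
      padicValNat.mul (hf a (Finset.mem_insert_self a s))
        (Finset.prod_ne_zero_iff.mpr fun i hi ↦ hf i (Finset.mem_insert_of_mem hi)),
      ih fun i hi ↦ hf i (Finset.mem_insert_of_mem hi)]

/-- **`c_ℓ(Wd) = c_ℓ(W)` when `d` is a non-zero square in `ℚ_ℓ`**: `Wd = Cd • W^{(d)}` and `W^{(θ²)} ≅ W` over
`ℚ_ℓ` (`exists_variableChange_smul_eq_quadraticTwist_sq`), and the local Tamagawa number is an isomorphism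
invariant (Silverman *AEC* VII.6 Ex. 7.6). [cite: SilvermanAEC2009, X.5 Cor. 5.4 and VII.6 Ex. 7.6] -/
theorem localTamagawaNumber_twist_eq_of_isSquare (W : WeierstrassCurve ℚ) [W.IsElliptic] (ℓ : ℕ)
    [Fact ℓ.Prime] {d : ℤ} (hd0 : d ≠ 0) (hsq : IsSquare ((d : ℤ) : ℚ_[ℓ]))
    {Wd : WeierstrassCurve ℚ} (Cd : VariableChange ℚ) (hWd : Cd • W.quadraticTwist (d : ℚ) = Wd) :
    (Wd.baseChange ℚ_[ℓ]).localTamagawaNumber ℤ_[ℓ] = (W.baseChange ℚ_[ℓ]).localTamagawaNumber ℤ_[ℓ] := by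
  have hD0 : (d : ℚ) ≠ 0 := by exact_mod_cast hd0
  haveI : (W.baseChange ℚ_[ℓ]).IsElliptic := inferInstanceAs (W.map (algebraMap ℚ ℚ_[ℓ])).IsElliptic
  obtain ⟨θ, hθ⟩ := hsq
  have hθ' : algebraMap ℚ ℚ_[ℓ] (d : ℚ) = θ * θ := by rw [map_intCast]; exact hθ
  have hθ0 : θ ≠ 0 := by
    rintro rfl
    exact (map_ne_zero (algebraMap ℚ ℚ_[ℓ])).mpr hD0 (hθ'.trans (mul_zero 0))
  obtain ⟨C, hC⟩ := (W.baseChange ℚ_[ℓ]).exists_variableChange_smul_eq_quadraticTwist_sq hθ0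
  have h1 : (W.quadraticTwist (d : ℚ)).baseChange ℚ_[ℓ] = C • W.baseChange ℚ_[ℓ] := by
    rw [hC, baseChange, baseChange, map_quadraticTwist, hθ', sq]
  have hYX : Wd.baseChange ℚ_[ℓ] = (Cd.map (algebraMap ℚ ℚ_[ℓ]) * C) • W.baseChange ℚ_[ℓ] := by
    rw [← hWd, WeierstrassCurve.VariableChange.baseChange_smul_eq (W.quadraticTwist (d : ℚ)) Cd ℚ_[ℓ],
      h1, mul_smul]
  rw [hYX, localTamagawaNumber_variableChange_holds ℤ_[ℓ] (W.baseChange ℚ_[ℓ])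
    (Cd.map (algebraMap ℚ ℚ_[ℓ]) * C)]

/-- **`c_ℓ(Wd) = c_ℓ(W)` at every prime `ℓ ∤ d` for a door-admissible `d`.** If `ℓ` is bad for `W`: `ℓ = 2` and
`d ≡ 1 (mod 8)`, or `ℓ` odd with `(d/ℓ) = 1`, make `d` a square in `ℚ_ℓ` (`localTamagawaNumber_twist_eq_of_isSquare`);
if `ℓ` is good for `W`: the twist by `d ≡ 1 (mod 4)`, `ℓ ∤ d`, is good at `ℓ` as well and both numbers are `1`
(`X2.localTamagawaNumber_twist_of_not_dvd`). [cite: Kramer1981, Prop. 3] -/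
theorem localTamagawaNumber_twist_eq_of_not_dvd (W : WeierstrassCurve ℚ) [W.IsElliptic] [W.IsGloballyMinimal]
    {d : ℤ} (hd : DoorAdmissible W d) (ℓ : ℕ) [Fact ℓ.Prime] (hℓd : ¬ (ℓ : ℤ) ∣ d)
    {Wd : WeierstrassCurve ℚ} [Wd.IsElliptic] (Cd : VariableChange ℚ)
    (hWd : Cd • W.quadraticTwist (d : ℚ) = Wd) :
    (Wd.baseChange ℚ_[ℓ]).localTamagawaNumber ℤ_[ℓ] = (W.baseChange ℚ_[ℓ]).localTamagawaNumber ℤ_[ℓ] := by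
  have hℓP : ℓ.Prime := Fact.out
  obtain ⟨hdneg, -, hd8, -, hjac⟩ := hd
  have hd0 : d ≠ 0 := hdneg.ne
  by_cases hgood : W.HasGoodReductionAtPrime ℓ
  · -- good for `W`: both local numbers are `1`
    haveI : (W.baseChange ℚ_[ℓ]).IsElliptic := inferInstanceAs (W.map (algebraMap ℚ ℚ_[ℓ])).IsElliptic
    have hcW : (W.baseChange ℚ_[ℓ]).localTamagawaNumber ℤ_[ℓ] = 1 := by
      haveI : ((W.baseChange ℚ_[ℓ]).minimal ℤ_[ℓ]).HasGoodReduction ℤ_[ℓ] := hgood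
      exact localTamagawaNumber_eq_one_of_hasGoodReduction_holds ℤ_[ℓ] _
    have h4 : d = 4 * (2 * (d / 8)) + 1 := by omega
    rw [hcW, X2.localTamagawaNumber_twist_of_not_dvd W ℓ h4 hℓd hgood Cd hWd]
  · -- bad for `W`: `d` is a square in `ℚ_ℓ`
    refine localTamagawaNumber_twist_eq_of_isSquare W ℓ hd0 ?_ Cd hWd
    by_cases hℓ2 : ℓ = 2
    · subst hℓ2
      exact KramerLocal.padicTwo_isSquare_intCast (by omega)
    · exact padic_isSquare_of_jacobiSym_eq_one hℓ2 (hjac ℓ hℓP hℓ2 fun _ => hgood)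

/-! ### §2 The registered stub `stub_doorTamagawa : DoorTwistTamagawaAtTwo`, proved -/

/-- **`DoorTwistTamagawaAtTwo` (V3 of the line `one_door_law`, registered stub `stub_doorTamagawa`) holds:
`ord₂ ∏_ℓ c_ℓ(Wd) = ord₂ ∏_ℓ c_ℓ(W) + t(W,d) + 2 s(W,d)`** for `W/ℚ` globally minimal, `d` door-admissible
(`d` squarefree, `d ≡ 1 (mod 8)`, all `q ∣ d` good, `(d/ℓ) = 1` at the odd bad `ℓ`) and any globally minimal
`Wd = Cd • W^{(d)}`.  Both products are finite products of `ℓ`-adic local Tamagawa numbers over the bad places of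
`W`, `Wd` and the primes of `d` (`tamagawaProduct_eq_prod`); at `ℓ ∤ d` the factors agree
(`localTamagawaNumber_twist_eq_of_not_dvd`), at `q ∣ d` (`q` odd, good, `q ∥ d`) `c_q(W) = 1` and
`ord₂ c_q(Wd) = [(Δ/q) = −1] + 2·[(Δ/q) = 1 ∧ a_q even]` (Tate `I₀*`, `c_q(Wd) = #Ẽ(𝔽_q)[2]`;
`TwistIstar.padicValNat_two_localTamagawaNumber_twist_of_dvd`), and summing over the prime factors of `|d|`
gives `t + 2s`. [cite: Kramer1981, Prop. 3] [cite: SilvermanATAEC1994, IV.9.4 Step 6 (PDF p. 345)] -/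
theorem doorTwistTamagawaAtTwo : DoorTwistTamagawaAtTwo := by
  intro W _ _ d hd Wd _ _ Cd hWd
  have hfact2 : Fact (Nat.Prime 2) := ⟨Nat.prime_two⟩
  obtain ⟨hdneg, hsqf, hd8, hgoodd, hjac⟩ := hd
  have hd0 : d ≠ 0 := hdneg.ne
  have hdodd : ¬ (2 : ℤ) ∣ d := by omega
  -- the finite set of places: bad places of `W`, of `Wd`, and the primes of `d`
  have hfW : (W.badPlaces ℤ).Finite := W.finite_badPlaces_holds ℤ
  have hfWd : (Wd.badPlaces ℤ).Finite := Wd.finite_badPlaces_holds ℤ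
  set P : Finset ℕ := d.natAbs.primeFactors with hP
  have hPmem : ∀ q, q ∈ P ↔ q.Prime ∧ (q : ℤ) ∣ d := by
    intro q
    rw [hP, Nat.mem_primeFactors, Int.natCast_dvd]
    exact ⟨fun h => ⟨h.1, h.2.1⟩, fun h => ⟨h.1, h.2, Int.natAbs_ne_zero.mpr hd0⟩⟩
  set D : Finset (HeightOneSpectrum ℤ) :=
    P.attach.image fun q => (primesEquiv (R := ℤ)).symm ⟨q.1, ((hPmem q.1).mp q.2).1⟩ with hD
  set s : Finset (HeightOneSpectrum ℤ) := hfW.toFinset ∪ hfWd.toFinset ∪ D with hs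
  have hsW : ∀ v, ¬ W.HasGoodReductionAt v → v ∈ s := fun v hv ↦
    Finset.mem_union_left _ (Finset.mem_union_left _
      (by rw [Set.Finite.mem_toFinset, mem_badPlaces_iff]; exact hv))
  have hsWd : ∀ v, ¬ Wd.HasGoodReductionAt v → v ∈ s := fun v hv ↦
    Finset.mem_union_left _ (Finset.mem_union_right _
      (by rw [Set.Finite.mem_toFinset, mem_badPlaces_iff]; exact hv))
  have hsD : ∀ q (hq : q ∈ P), (primesEquiv (R := ℤ)).symm ⟨q, ((hPmem q).mp hq).1⟩ ∈ s := fun q hq ↦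
    Finset.mem_union_right _ (Finset.mem_image.mpr ⟨⟨q, hq⟩, Finset.mem_attach _ _, rfl⟩)
  -- local Tamagawa numbers as functions of the place
  set cW : HeightOneSpectrum ℤ → ℕ := fun v =>
    haveI := Fact.mk (primesEquiv v).2
    (W.baseChange ℚ_[primesEquiv v]).localTamagawaNumber ℤ_[primesEquiv v] with hcW
  set cWd : HeightOneSpectrum ℤ → ℕ := fun v =>
    haveI := Fact.mk (primesEquiv v).2
    (Wd.baseChange ℚ_[primesEquiv v]).localTamagawaNumber ℤ_[primesEquiv v] with hcWd
  have hcW0 : ∀ v ∈ s, cW v ≠ 0 := fun v _ ↦ by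
    haveI := Fact.mk (primesEquiv v).2
    haveI : (W.baseChange ℚ_[primesEquiv v]).IsElliptic :=
      inferInstanceAs (W.map (algebraMap ℚ ℚ_[primesEquiv v])).IsElliptic
    exact localTamagawaNumber_padic_ne_zero_holds (primesEquiv v) _
  have hcWd0 : ∀ v ∈ s, cWd v ≠ 0 := fun v _ ↦ by
    haveI := Fact.mk (primesEquiv v).2
    haveI : (Wd.baseChange ℚ_[primesEquiv v]).IsElliptic :=
      inferInstanceAs (Wd.map (algebraMap ℚ ℚ_[primesEquiv v])).IsElliptic
    exact localTamagawaNumber_padic_ne_zero_holds (primesEquiv v) _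
  have hprodW : W.tamagawaProduct = ∏ v ∈ s, cW v := tamagawaProduct_eq_prod W s hsW
  have hprodWd : Wd.tamagawaProduct = ∏ v ∈ s, cWd v := tamagawaProduct_eq_prod Wd s hsWd
  rw [hprodW, hprodWd, padicValNat_finset_prod 2 s cW hcW0, padicValNat_finset_prod 2 s cWd hcWd0]
  -- the summand at the door primes
  set g : ℕ → ℕ := fun q =>
    (if jacobiSym W.Δ.num q = -1 then 1 else 0) +
      (if jacobiSym W.Δ.num q = 1 ∧ Even (W.frobeniusTrace q) then 2 else 0) with hg
  -- place by place
  have hloc : ∀ v ∈ s, padicValNat 2 (cWd v) =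
      padicValNat 2 (cW v) + if ((primesEquiv v : ℕ) : ℤ) ∣ d then g (primesEquiv v) else 0 := by
    intro v _
    haveI := Fact.mk (primesEquiv v).2
    set ℓ : ℕ := (primesEquiv v : ℕ) with hℓ
    have hℓP : ℓ.Prime := (primesEquiv v).2
    by_cases hℓd : (ℓ : ℤ) ∣ d
    · -- a door prime: `c_ℓ(W) = 1`, `ord₂ c_ℓ(Wd) = g ℓ`
      rw [if_pos hℓd]
      have hgood : W.HasGoodReductionAtPrime ℓ := hgoodd ℓ hℓP hℓd _
      have hℓ2 : ℓ ≠ 2 := by rintro h; rw [h] at hℓd; exact hdodd (by exact_mod_cast hℓd)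
      have hℓΔ : ¬ (ℓ : ℤ) ∣ minimalDiscriminantInt W :=
        not_dvd_minimalDiscriminantInt_of_hasGoodReductionAtPrime W ℓ hgood
      have hℓ2d : ¬ (ℓ : ℤ) ^ 2 ∣ d := by
        intro h
        have hunit := hsqf (ℓ : ℤ) (by rw [← sq]; exact h)
        rw [Int.isUnit_iff_natAbs_eq, Int.natAbs_natCast] at hunit
        exact hℓP.one_lt.ne' hunit
      have h1 : cW v = 1 := by
        haveI : (W.baseChange ℚ_[ℓ]).IsElliptic := inferInstanceAs (W.map (algebraMap ℚ ℚ_[ℓ])).IsElliptic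
        haveI : ((W.baseChange ℚ_[ℓ]).minimal ℤ_[ℓ]).HasGoodReduction ℤ_[ℓ] := hgood
        exact localTamagawaNumber_eq_one_of_hasGoodReduction_holds ℤ_[ℓ] _
      rw [h1, padicValNat_one_right, zero_add]
      exact padicValNat_two_localTamagawaNumber_twist_of_dvd W ℓ hℓ2 hℓΔ hℓd hℓ2d Cd hWd
    · rw [if_neg hℓd, add_zero]
      exact congrArg _
        (localTamagawaNumber_twist_eq_of_not_dvd W ⟨hdneg, hsqf, hd8, hgoodd, hjac⟩ ℓ hℓd Cd hWd)
  rw [Finset.sum_congr rfl hloc, Finset.sum_add_distrib, ← Finset.sum_filter]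
  -- the door-prime part of the sum is indexed by the prime factors of `|d|`
  have hfilter : ∑ v ∈ s.filter (fun v => ((primesEquiv v : ℕ) : ℤ) ∣ d), g (primesEquiv v) =
      ∑ q ∈ P, g q := by
    refine Finset.sum_nbij' (fun v => (primesEquiv v : ℕ))
      (fun q => if h : q.Prime then (primesEquiv (R := ℤ)).symm ⟨q, h⟩
        else (primesEquiv (R := ℤ)).symm ⟨2, Nat.prime_two⟩)
      (fun v hv => ?_) (fun q hq => ?_) (fun v hv => ?_) (fun q hq => ?_) (fun v _ => rfl)
    · rw [Finset.mem_filter] at hv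
      rw [hPmem]
      exact ⟨(primesEquiv v).2, hv.2⟩
    · have hq' := (hPmem q).mp hq
      rw [Finset.mem_filter, dif_pos hq'.1, Equiv.apply_symm_apply]
      exact ⟨hsD q hq, hq'.2⟩
    · simp only [dif_pos (primesEquiv v).2, Subtype.coe_eta, Equiv.symm_apply_apply]
    · simp only [dif_pos ((hPmem q).mp hq).1, Equiv.apply_symm_apply, Subtype.coe_mk]
  rw [hfilter]
  -- `Σ_{q ∣ d} g(q) = t + 2 s`
  have hcount : ∑ q ∈ P, g q = transpCount W d + 2 * identCount W d := by
    simp only [hg, transpCount, identCount, Finset.sum_add_distrib, Finset.card_filter, Finset.mul_sum,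
      ← hP]
    congr 1
    refine Finset.sum_congr rfl fun q _ => ?_
    split_ifs <;> simp
  rw [hcount]
  ring

/-- Alias under the registered stub name of the skeleton `Lines/one_door_law.lean` (v7.3):
`stub_doorTamagawa : DoorTwistTamagawaAtTwo`. [cite: Kramer1981, Prop. 3] -/
theorem stub_doorTamagawa : DoorTwistTamagawaAtTwo := doorTwistTamagawaAtTwo

end Summit.BirchSwinnertonDyer.BirchSwinnertonDyer.Theorems.RankOneAtTwoOneDoor

end
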